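import Mathlib.Analysis.Calculus.ContDiff.Convolution
import Literature.Analysis.FluidPDE.ClassicalLqRateEnergy
import Literature.Analysis.FluidPDE.ClassicalSolutionRegion
import HarnessLib

/-!
# The pressure class up to the top time for classical `L^q` solutions with a subcritical rate

Analysis/FluidPDE proofs file (theorems only; no definitions, no named facts) on the discharge
path of the named fact `Literature.Analysis.FluidPDE.chaeWolf2017_dss_typeI_decay`
(`ChaeWolfRemovingDSS.lean`; D. Chae, J. Wolf, arXiv:1610.09464, Thm. 1.1). Companion of
`ClassicalLqRateEnergy.lean` (the energy classes (2.4c)); here the **pressure**: Chae–Wolf's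
pressure in Step 4 is the Calderón–Zygmund pressure `π = RᵢRⱼ(uᵢuⱼ)`, which by (2.4b) is in
`L^{q/2}` in space with `‖π(t)‖_{q/2} ≲ ‖u(t)‖_q² ≲ (−t)^{−2κ}`, hence locally in `L^{3/2}` of every
backward cylinder up to the top time as soon as `3κ < 1`. The vendored statement has an
*arbitrary* smooth pressure `p`, equal to `π(t) + C(t)` with an uncontrolled `C(t)`
(`PressureNormalisationLq`); we therefore renormalise it by a **smooth** function of time,
`m(t) = ∫ Θ(y) p(t, x₀ − y) dy` (`Θ` a normed bump at scale `ρ` — so that `m` is smooth in `t`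
by differentiation under the integral, Mathlib's `contDiffOn_convolution_right_with_param_comp`),
for which `p(t) − m(t) = π(t) − (Θ ⋆ π(t))(x₀)` a.e.:

* `exists_smooth_normaliser` — the function `m`, smooth on `(−∞, 0)`, with
  `m(t) = (Θ ⋆ p(t))(x₀)`;
* `isClassicalNSSolutionOnRegion_sub_normaliser` — `(u, p − m)` is a classical solution on the
  open cylinder `Q_ρ(0, x₀)` (the momentum equation only sees `∇p`);
* `lintegral_ball_pressure_sub_le` — the slice bound
  `∫_{B(x₀,ρ)} |p(t) − m(t)|^{3/2} ≤ C ‖u(t)‖_q³`-type, through `p − m = π − (Θ ⋆ π)(x₀)`;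
* `IsClassicalNSSolutionOn.exists_pressure_class_of_rate` — **the conclusion**: under the rate
  `‖u(t)‖_{L^q} ≤ K₀(−t)^{−κ}` on `(−T, 0)`, `3κ < 1`, `3 ≤ q`, for every cylinder `Q_ρ(0, x₀)` with
  `ρ² < T` there is a smooth `m` on `(−∞, 0)` such that `(u, p − m)` is classical on `Q_ρ(0, x₀)`
  and `p − m ∈ L^{3/2}(Q_ρ(0, x₀))`.

## References

* D. Chae, J. Wolf, arXiv:1610.09464, §2 Step 2 (2.4b) (p. 5) and Step 4 (p. 6–7).
  [ChaeWolf2017RemovingDSS]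
-/

noncomputable section

open MeasureTheory TopologicalSpace Set Function Filter Metric
open _root_.Topology
open scoped Laplacian InnerProductSpace RealInnerProductSpace ENNReal NNReal ContDiff Convolution

namespace Literature.Analysis.FluidPDE

namespace ChaeWolfEnergy

open PressureNormalisation PressureNormalisationL3

variable {u : ℝ → (EuclideanSpace ℝ (Fin 3)) → (EuclideanSpace ℝ (Fin 3))}
  {p : ℝ → (EuclideanSpace ℝ (Fin 3)) → ℝ}

/-! ### The smooth normaliser -/

/-- **A smooth-in-time local average of the pressure.** For a classical solution on `(−∞, 0)`,
a point `x₀` and a normed bump `Θ` (`ContDiffBump 0`, normed) there is `m : ℝ → ℝ`, smooth on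
`(−∞, 0)`, with `m(t) = ∫ Θ(y) p(t, x₀ − y) dy` for `t < 0` (differentiation under the integral
sign: Mathlib's `contDiffOn_convolution_right_with_param_comp`, applied to the pressure cut off
far from `x₀`). [folklore] -/
theorem exists_smooth_normaliser {S : Set ℝ} {ν : ℝ} {f : ℝ → (EuclideanSpace ℝ (Fin 3)) → (EuclideanSpace ℝ (Fin 3))}
    (hsol : IsClassicalNSSolutionOn S ν f u p) (hS : IsOpen S)
    (x₀ : (EuclideanSpace ℝ (Fin 3))) (θ : ContDiffBump (0 : (EuclideanSpace ℝ (Fin 3)))) :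
    ∃ m : ℝ → ℝ, ContDiffOn ℝ ∞ m S ∧
      ∀ t ∈ S, m t = ∫ y, θ.normed volume y * p t (x₀ - y) := by
  -- a cut-off equal to `1` on `B̄(x₀, rOut)`
  let χ : ContDiffBump x₀ := ⟨θ.rOut, θ.rOut + 1, θ.rOut_pos, by linarith⟩
  set g : ℝ → (EuclideanSpace ℝ (Fin 3)) → ℝ := fun t y => χ y * p t y with hg
  have hgs : ∀ t y, t ∈ S → y ∉ closedBall x₀ (θ.rOut + 1) → g t y = 0 := by
    intro t y _ hy
    have : χ y = 0 := by
      have hy' : y ∉ tsupport (χ : (EuclideanSpace ℝ (Fin 3)) → ℝ) := by rwa [χ.tsupport_eq]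
      exact image_eq_zero_of_notMem_tsupport hy'
    simp [hg, this]
  have hgsmooth : ContDiffOn ℝ (⊤ : ℕ∞) (↿g) (S ×ˢ univ) := by
    have h1 : ContDiffOn ℝ (⊤ : ℕ∞) (fun z : ℝ × (EuclideanSpace ℝ (Fin 3)) => χ z.2) (S ×ˢ univ) :=
      (χ.contDiff.comp contDiff_snd).contDiffOn
    exact h1.mul hsol.smooth_pressure
  have hθloc : LocallyIntegrable (θ.normed volume) volume := θ.continuous_normed.locallyIntegrable
  have key := contDiffOn_convolution_right_with_param_comp (𝕜 := ℝ) (μ := volume)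
    (ContinuousLinearMap.lsmul ℝ ℝ) (n := (⊤ : ℕ∞)) (v := fun _ : ℝ => x₀) contDiffOn_const hS
    (isCompact_closedBall x₀ (θ.rOut + 1)) hgs hθloc hgsmooth
  refine ⟨fun t => (θ.normed volume ⋆[ContinuousLinearMap.lsmul ℝ ℝ, volume] g t) x₀, key, fun t _ => ?_⟩
  -- the value: `χ(x₀ − y) = 1` where `Θ(y) ≠ 0`
  show (θ.normed volume ⋆[ContinuousLinearMap.lsmul ℝ ℝ, volume] g t) x₀ = ∫ y, θ.normed volume y * p t (x₀ - y)
  rw [convolution_def]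
  refine integral_congr_ae (Eventually.of_forall fun y => ?_)
  simp only [ContinuousLinearMap.lsmul_apply, smul_eq_mul, hg]
  by_cases hy : y ∈ ball (0 : (EuclideanSpace ℝ (Fin 3))) θ.rOut
  · have hχ : χ (x₀ - y) = 1 := by
      refine χ.one_of_mem_closedBall ?_
      rw [mem_closedBall, dist_eq_norm, sub_sub_cancel_left, norm_neg]
      exact (mem_ball_zero_iff.1 hy).le
    rw [hχ, one_mul]
  · have hθ0 : θ.normed volume y = 0 := by
      have : y ∉ Function.support (θ.normed volume) := by rwa [θ.support_normed_eq]
      simpa [Function.mem_support] using this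
    simp [hθ0]

/-- **Renormalising the pressure by a smooth function of time keeps the classical solution**
(the momentum equation only involves `∇p`): if `(u, p)` is a classical solution on `(−∞, 0)` and
`m` is smooth on `(−∞, 0)`, then `(u, p − m)` is a classical solution on every backward cylinder
`Q_ρ(0, x₀)`. [folklore] -/
theorem isClassicalNSSolutionOnRegion_sub_normaliser {ν : ℝ}
    (hsol : IsClassicalNSSolutionOn (Iio 0) ν 0 u p) {m : ℝ → ℝ} (hm : ContDiffOn ℝ ∞ m (Iio 0))
    (x₀ : (EuclideanSpace ℝ (Fin 3))) (ρ : ℝ) :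
    IsClassicalNSSolutionOnRegion (parabolicCylinder ρ ((0 : ℝ), x₀)) ν 0 u fun t x => p t x - m t := by
  have hO : IsOpen (parabolicCylinder ρ ((0 : ℝ), x₀)) := isOpen_parabolicCylinder _ _
  have hsub : parabolicCylinder ρ ((0 : ℝ), x₀) ⊆ Iio (0 : ℝ) ×ˢ (univ : Set (EuclideanSpace ℝ (Fin 3))) := by
    intro w hw
    rw [mem_parabolicCylinder] at hw
    exact ⟨(hw.1.2 : w.1 < 0), mem_univ _⟩
  have h0 : IsClassicalNSSolutionOnRegion (parabolicCylinder ρ ((0 : ℝ), x₀)) ν 0 u p :=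
    hsol.onRegion.mono_of_isOpen hsub hO
  obtain ⟨hu, hp, hmom, hdiv⟩ := (isClassicalNSSolutionOnRegion_iff_of_isOpen hO).1 h0
  rw [isClassicalNSSolutionOnRegion_iff_of_isOpen hO]
  refine ⟨hu, ?_, fun t x htx => ?_, hdiv⟩
  · have h1 : ContDiffOn ℝ ∞ (fun z : ℝ × (EuclideanSpace ℝ (Fin 3)) => m z.1)
        (parabolicCylinder ρ ((0 : ℝ), x₀)) :=
      hm.comp contDiffOn_fst fun w hw => (hsub hw).1
    exact hp.sub h1
  · have hg : gradient (fun x => p t x - m t) x = gradient (p t) x := by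
      simp only [gradient, fderiv_sub_const]
    rw [hg]
    exact hmom t x htx

/-! ### The slice bound of the renormalised pressure -/

/-- In `ℝ≥0∞`: `(a + b)^{3/2} ≤ 2^{1/2}(a^{3/2} + b^{3/2})`. [folklore] -/
private theorem rpow_threeHalves_add_le (a b : ℝ≥0∞) :
    (a + b) ^ (3 / 2 : ℝ) ≤ (2 : ℝ≥0∞) ^ (1 / 2 : ℝ) * (a ^ (3 / 2 : ℝ) + b ^ (3 / 2 : ℝ)) := by
  have h := ENNReal.rpow_add_le_mul_rpow_add_rpow a b (by norm_num : (1 : ℝ) ≤ 3 / 2)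
  norm_num at h
  exact h

/-- **The slice bound.** Let `Θ` be a normed bump of outer radius `ρ`, `pr` a pressure slice with
`pr = Q + C` a.e. (no regularity of `pr` is needed), `Q ∈ L^{q/2}`, `‖Q‖_{L^{q/2}} ≤ P`, `3 ≤ q`, and let
`m = ∫ Θ(y) pr(x₀ − y) dy`. Then `pr − m = Q − (Θ ⋆ Q)(x₀)` a.e., `|(Θ ⋆ Q)(x₀)| ≤ B_Θ |B̄_ρ|^{1−2/q} P`,
and `∫⁻_{B(x₀,ρ)} |pr − m|^{3/2} ≤ 2^{1/2}(|B̄_ρ|^{1−3/q} P^{3/2} + |B_ρ| (B_Θ |B̄_ρ|^{1−2/q} P)^{3/2})`,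
`B_Θ = sup Θ`. [folklore] -/
theorem lintegral_ball_pressure_sub_le {q : ℝ} (hq : 3 ≤ q) (x₀ : (EuclideanSpace ℝ (Fin 3)))
    (θ : ContDiffBump (0 : (EuclideanSpace ℝ (Fin 3)))) {BΘ : ℝ} (hBΘ : ∀ y, θ.normed volume y ≤ BΘ)
    {pr : (EuclideanSpace ℝ (Fin 3)) → ℝ}
    {Q : (EuclideanSpace ℝ (Fin 3)) → ℝ} (hQ : MemLp Q (ENNReal.ofReal (q / 2)) volume)
    {P : ℝ≥0} (hQP : eLpNorm Q (ENNReal.ofReal (q / 2)) volume ≤ P) {C : ℝ}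
    (hae : ∀ᵐ x ∂(volume : Measure (EuclideanSpace ℝ (Fin 3))), pr x = Q x + C)
    {m : ℝ} (hm : m = ∫ y, θ.normed volume y * pr (x₀ - y)) :
    ∫⁻ x in ball x₀ θ.rOut, ‖pr x - m‖ₑ ^ (3 / 2 : ℝ) ≤
      ENNReal.ofReal ((2 : ℝ) ^ (1 / 2 : ℝ) *
        (((volume : Measure (EuclideanSpace ℝ (Fin 3))).real (closedBall x₀ θ.rOut)) ^ (1 - 3 / q) *
            (P : ℝ) ^ (3 / 2 : ℝ) +
          ((volume : Measure (EuclideanSpace ℝ (Fin 3))).real (ball x₀ θ.rOut)) *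
            (BΘ * (((volume : Measure (EuclideanSpace ℝ (Fin 3))).real (closedBall x₀ θ.rOut)) ^
              (1 - 2 / q) * (P : ℝ))) ^ (3 / 2 : ℝ))) := by
  set ρ := θ.rOut with hρ
  set Θ := θ.normed volume with hΘ
  have hq2 : (2 : ℝ) ≤ q := by linarith
  have hq21 : (1 : ℝ≥0∞) ≤ ENNReal.ofReal (q / 2) := by
    rw [← ENNReal.ofReal_one]; exact ENNReal.ofReal_le_ofReal (by linarith)
  have hQloc : LocallyIntegrable Q volume := hQ.locallyIntegrable hq21
  have hΘc : Continuous Θ := θ.continuous_normed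
  have hΘcs : HasCompactSupport Θ := θ.hasCompactSupport_normed
  have hBΘ0 : 0 ≤ BΘ := (θ.nonneg_normed 0).trans (hBΘ 0)
  -- the averaged Riesz pressure `cQ = ∫ Θ(y) Q(x₀ - y) dy` and `m = cQ + C`
  set cQ : ℝ := ∫ y, Θ y * Q (x₀ - y) with hcQ
  have iQ : Integrable (fun y => Θ y * Q (x₀ - y)) volume :=
    (hΘcs.convolutionExists_left (ContinuousLinearMap.lsmul ℝ ℝ : ℝ →L[ℝ] ℝ →L[ℝ] ℝ) hΘc hQloc x₀).integrable
  have hae' : ∀ᵐ y ∂(volume : Measure (EuclideanSpace ℝ (Fin 3))), pr (x₀ - y) = Q (x₀ - y) + C :=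
    ((volume : Measure (EuclideanSpace ℝ (Fin 3))).measurePreserving_sub_left x₀).quasiMeasurePreserving.ae hae
  have hm' : m = cQ + C := by
    rw [hm]
    calc ∫ y, Θ y * pr (x₀ - y) = ∫ y, (Θ y * Q (x₀ - y) + C * Θ y) := by
          refine integral_congr_ae ?_
          filter_upwards [hae'] with y hy
          rw [hy]; ring
      _ = cQ + C * ∫ y, Θ y := by
          rw [integral_add iQ (θ.integrable_normed.const_mul C), integral_const_mul]
      _ = cQ + C := by rw [hΘ, θ.integral_normed, mul_one]
  -- `|cQ| ≤ B_Θ ∫_{B̄} |Q| ≤ B_Θ V^{1-2/q} P`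
  have hcQ_le : |cQ| ≤ BΘ * (((volume : Measure (EuclideanSpace ℝ (Fin 3))).real (closedBall x₀ ρ)) ^
      (1 - 2 / q) * (P : ℝ)) := by
    rw [hcQ, ← integral_sub_left_eq_self (fun y => Θ y * Q (x₀ - y)) volume x₀]
    simp only [sub_sub_cancel]
    have hF : ∀ y, ‖Θ (x₀ - y) * Q y‖ ≤ BΘ * |Q y| := fun y => by
      rw [norm_mul, Real.norm_of_nonneg (θ.nonneg_normed _), Real.norm_eq_abs]
      exact mul_le_mul_of_nonneg_right (hBΘ _) (abs_nonneg _)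
    have hF0 : ∀ y, ρ < dist y x₀ → Θ (x₀ - y) * Q y = 0 := fun y hy => by
      have : Θ (x₀ - y) = 0 := by
        have hns : x₀ - y ∉ Function.support Θ := by
          rw [hΘ, θ.support_normed_eq, mem_ball_zero_iff, not_lt, ← dist_eq_norm, dist_comm]
          exact hy.le
        simpa [Function.mem_support] using hns
      rw [this, zero_mul]
    have hFm : AEStronglyMeasurable (fun y => Θ (x₀ - y) * Q y) volume :=
      ((hΘc.comp (continuous_const.sub continuous_id)).aestronglyMeasurable).mul hQ.1
    obtain ⟨-, hI⟩ := norm_integral_le_of_kernel_bound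
      ((hQloc.integrableOn_isCompact (isCompact_closedBall x₀ ρ)).abs) hFm hF hF0
    rw [← Real.norm_eq_abs]
    refine hI.trans (mul_le_mul_of_nonneg_left ?_ hBΘ0)
    exact setIntegral_abs_le x₀ ρ hq2 hQ hQP
  -- the pointwise splitting
  have hsplit : ∀ᵐ x ∂(volume.restrict (ball x₀ ρ)),
      ‖pr x - m‖ₑ ^ (3 / 2 : ℝ) ≤ (2 : ℝ≥0∞) ^ (1 / 2 : ℝ) * (‖Q x‖ₑ ^ (3 / 2 : ℝ) + ‖cQ‖ₑ ^ (3 / 2 : ℝ)) := by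
    refine ae_restrict_of_ae ?_
    filter_upwards [hae] with x hx
    have e : pr x - m = Q x - cQ := by rw [hx, hm']; ring
    rw [e]
    calc ‖Q x - cQ‖ₑ ^ (3 / 2 : ℝ) ≤ (‖Q x‖ₑ + ‖cQ‖ₑ) ^ (3 / 2 : ℝ) :=
          ENNReal.rpow_le_rpow (enorm_sub_le) (by norm_num)
      _ ≤ _ := rpow_threeHalves_add_le _ _
  -- integrate
  obtain ⟨iQ32, bQ32⟩ := setIntegral_abs_rpow_threeHalves_le x₀ ρ hq hQ hQP
  have iQ32' : IntegrableOn (fun y => |Q y| ^ (3 / 2 : ℝ)) (ball x₀ ρ) volume :=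
    iQ32.mono_set ball_subset_closedBall
  have hQint : ∫⁻ x in ball x₀ ρ, ‖Q x‖ₑ ^ (3 / 2 : ℝ) ≤
      ENNReal.ofReal ((((volume : Measure (EuclideanSpace ℝ (Fin 3))).real (closedBall x₀ ρ)) ^
        (1 - 3 / q) * (P : ℝ) ^ (3 / 2 : ℝ))) := by
    have e1 : ∫⁻ x in ball x₀ ρ, ‖Q x‖ₑ ^ (3 / 2 : ℝ) = ∫⁻ x in ball x₀ ρ, ENNReal.ofReal (|Q x| ^ (3 / 2 : ℝ)) := by
      refine lintegral_congr fun x => ?_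
      rw [Real.enorm_eq_ofReal_abs, ENNReal.ofReal_rpow_of_nonneg (abs_nonneg _) (by norm_num)]
    rw [e1, ← ofReal_integral_eq_lintegral_ofReal iQ32' (ae_of_all _ fun x => by positivity)]
    refine ENNReal.ofReal_le_ofReal ((setIntegral_mono_set iQ32 (ae_of_all _ fun x => by positivity)
      ball_subset_closedBall.eventuallyLE).trans bQ32)
  have hcint : ∫⁻ _ in ball x₀ ρ, ‖cQ‖ₑ ^ (3 / 2 : ℝ) ≤
      ENNReal.ofReal (((volume : Measure (EuclideanSpace ℝ (Fin 3))).real (ball x₀ ρ)) *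
        (BΘ * (((volume : Measure (EuclideanSpace ℝ (Fin 3))).real (closedBall x₀ ρ)) ^
          (1 - 2 / q) * (P : ℝ))) ^ (3 / 2 : ℝ)) := by
    rw [setLIntegral_const, mul_comm, Real.enorm_eq_ofReal_abs,
      ENNReal.ofReal_rpow_of_nonneg (abs_nonneg _) (by norm_num),
      ENNReal.ofReal_mul measureReal_nonneg, ofReal_measureReal (measure_ball_lt_top).ne]
    gcongr
  calc ∫⁻ x in ball x₀ ρ, ‖pr x - m‖ₑ ^ (3 / 2 : ℝ)
      ≤ ∫⁻ x in ball x₀ ρ, (2 : ℝ≥0∞) ^ (1 / 2 : ℝ) * (‖Q x‖ₑ ^ (3 / 2 : ℝ) + ‖cQ‖ₑ ^ (3 / 2 : ℝ)) :=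
        lintegral_mono_ae hsplit
    _ = (2 : ℝ≥0∞) ^ (1 / 2 : ℝ) * ((∫⁻ x in ball x₀ ρ, ‖Q x‖ₑ ^ (3 / 2 : ℝ)) +
          ∫⁻ _ in ball x₀ ρ, ‖cQ‖ₑ ^ (3 / 2 : ℝ)) := by
        rw [lintegral_const_mul' _ _ (ENNReal.rpow_ne_top_of_nonneg (by norm_num) ENNReal.ofNat_ne_top),
          lintegral_add_right _ measurable_const]
    _ ≤ (2 : ℝ≥0∞) ^ (1 / 2 : ℝ) * (ENNReal.ofReal ((((volume : Measure (EuclideanSpace ℝ (Fin 3))).real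
            (closedBall x₀ ρ)) ^ (1 - 3 / q) * (P : ℝ) ^ (3 / 2 : ℝ))) +
          ENNReal.ofReal (((volume : Measure (EuclideanSpace ℝ (Fin 3))).real (ball x₀ ρ)) *
            (BΘ * (((volume : Measure (EuclideanSpace ℝ (Fin 3))).real (closedBall x₀ ρ)) ^
              (1 - 2 / q) * (P : ℝ))) ^ (3 / 2 : ℝ))) := by
        gcongr
    _ = _ := by
        rw [← ENNReal.ofReal_add (by positivity) (by positivity), ENNReal.ofReal_mul (by positivity),
          ← ENNReal.ofReal_rpow_of_nonneg (by norm_num : (0:ℝ) ≤ 2) (by norm_num), ENNReal.ofReal_ofNat]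

/-! ### The pressure class up to the top -/

/-- The rate majorant `s ↦ (−s)^{−3κ}` is integrable on `(a, 0)` for `3κ < 1`. [folklore] -/
theorem integrableOn_rpow_neg_Ioo {κ : ℝ} (hκ3 : 3 * κ < 1) (a : ℝ) :
    IntegrableOn (fun s : ℝ => (-s) ^ (-(3 * κ))) (Ioo a 0) volume := by
  have h1 : IntervalIntegrable (fun x : ℝ => x ^ (-(3 * κ))) volume (-a) 0 :=
    intervalIntegral.intervalIntegrable_rpow' (by linarith)
  have h2 := h1.comp_sub_left 0
  simp only [zero_sub, sub_zero, neg_neg] at h2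
  exact h2.1.mono_set Ioo_subset_Ioc_self

/-- **The renormalised pressure is in `L^{3/2}` of every cylinder up to the top** (the pressure
hypothesis of the ε-regularity theory for Chae–Wolf's solutions in the range `3κ < 1`). For a
classical solution of the unforced system (`ν = 1`) on `ℝ³ × (−∞, 0)` with `u(t) ∈ L^q`, `3 ≤ q`,
and the rate `‖u(t)‖_{L^q} ≤ K₀(−t)^{−κ}` on `(−T, 0)`, `3κ < 1`, and every cylinder `Q_ρ(0, x₀)`,
`ρ² < T`: there is `m`, smooth on `(−∞, 0)`, such that `(u, p − m)` is a classical solution on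
`Q_ρ(0, x₀)` and `p − m ∈ L^{3/2}(Q_ρ(0, x₀))`. [cite: ChaeWolf2017RemovingDSS, §2 Step 2 (2.4b) and Step 4 (arXiv p. 5–7)] -/
theorem _root_.Literature.Analysis.FluidPDE.IsClassicalNSSolutionOn.exists_pressure_class_of_rate
    (hsol : IsClassicalNSSolutionOn (Iio 0) 1 0 u p)
    {q : ℝ} (hq : 3 ≤ q) {κ K₀ T : ℝ} (hκ : 0 ≤ κ) (hκ3 : 3 * κ < 1) (hK₀ : 0 ≤ K₀)
    (hLq : ∀ t ∈ Ioo (-T) 0, MemLp (u t) (ENNReal.ofReal q) volume)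
    (hrate : ∀ t ∈ Ioo (-T) 0,
      eLpNorm (u t) (ENNReal.ofReal q) volume ≤ ENNReal.ofReal (K₀ * (-t) ^ (-κ)))
    (x₀ : (EuclideanSpace ℝ (Fin 3))) {ρ : ℝ} (hρ : 0 < ρ) (hρT : ρ ^ 2 < T) :
    ∃ m : ℝ → ℝ, ContDiffOn ℝ ∞ m (Iio 0) ∧
      IsClassicalNSSolutionOnRegion (parabolicCylinder ρ ((0 : ℝ), x₀)) 1 0 u (fun t x => p t x - m t) ∧
      MemLp (uncurry fun t x => p t x - m t) (3 / 2)
        (volume.restrict (parabolicCylinder ρ ((0 : ℝ), x₀))) := by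
  have hS : IsOpen (Iio (0 : ℝ)) := isOpen_Iio
  have hq2 : (2 : ℝ) < q := by linarith
  -- the bump at scale `ρ` and the normaliser
  let θ : ContDiffBump (0 : (EuclideanSpace ℝ (Fin 3))) := ⟨ρ / 2, ρ, by positivity, by linarith⟩
  have hθρ : θ.rOut = ρ := rfl
  obtain ⟨m, hm, hmval⟩ := exists_smooth_normaliser hsol hS x₀ θ
  refine ⟨m, hm, isClassicalNSSolutionOnRegion_sub_normaliser hsol hm x₀ ρ, ?_⟩
  -- the sup of the normed bump
  set BΘ : ℝ := 1 / (volume : Measure (EuclideanSpace ℝ (Fin 3))).real (closedBall (0 : (EuclideanSpace ℝ (Fin 3))) θ.rIn) with hBΘ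
  have hBΘle : ∀ y, θ.normed volume y ≤ BΘ := fun y => θ.normed_le_div_measure_closedBall_rIn volume y
  have hBΘ0 : 0 ≤ BΘ := (θ.nonneg_normed 0).trans (hBΘle 0)
  -- slice pressures
  obtain ⟨Cq, hQex⟩ := exists_rieszPressure_slice_of_rate hsol hq2 hκ hK₀ hLq hrate
  choose! Qt hQt hQtb hQteq Ct hCt using hQex
  -- constants
  set Vc : ℝ := (volume : Measure (EuclideanSpace ℝ (Fin 3))).real (closedBall x₀ ρ) with hVc
  set Vb : ℝ := (volume : Measure (EuclideanSpace ℝ (Fin 3))).real (ball x₀ ρ) with hVb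
  have hVc0 : 0 ≤ Vc := measureReal_nonneg
  have hVb0 : 0 ≤ Vb := measureReal_nonneg
  set A : ℝ := (2 : ℝ) ^ (1 / 2 : ℝ) * (Vc ^ (1 - 3 / q) * ((Cq : ℝ) ^ (3 / 2 : ℝ) * K₀ ^ 3) +
    Vb * (BΘ ^ (3 / 2 : ℝ) * (Vc ^ (1 - 2 / q)) ^ (3 / 2 : ℝ) * ((Cq : ℝ) ^ (3 / 2 : ℝ) * K₀ ^ 3)))
    with hA
  have hA0 : 0 ≤ A := by positivity
  -- the slice bound for `t ∈ (−T, 0)`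
  have hslice : ∀ t ∈ Ioo (-T) 0,
      ∫⁻ x in ball x₀ ρ, ‖p t x - m t‖ₑ ^ (3 / 2 : ℝ) ≤ ENNReal.ofReal (A * (-t) ^ (-(3 * κ))) := by
    intro t ht
    have ht0 : 0 < -t := by linarith [ht.2]
    set M : ℝ≥0 := (K₀ * (-t) ^ (-κ)).toNNReal with hM
    have hMval : (M : ℝ) = K₀ * (-t) ^ (-κ) :=
      Real.coe_toNNReal _ (mul_nonneg hK₀ (Real.rpow_nonneg ht0.le _))
    have hvM : eLpNorm (u t) (ENNReal.ofReal q) volume ≤ M := hrate t ht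
    set P : ℝ≥0 := Cq * M ^ 2 with hP
    have hQP : eLpNorm (Qt t) (ENNReal.ofReal (q / 2)) volume ≤ P := by
      calc eLpNorm (Qt t) (ENNReal.ofReal (q / 2)) volume
          ≤ Cq * eLpNorm (u t) (ENNReal.ofReal q) volume ^ 2 := hQtb t ht
        _ ≤ Cq * (M : ℝ≥0∞) ^ 2 := by gcongr
        _ = (P : ℝ≥0∞) := by rw [hP]; push_cast; ring
    have key := lintegral_ball_pressure_sub_le hq x₀ θ hBΘle (hQt t ht) hQP (hCt t ht) (hmval t ht.2)
    rw [hθρ] at key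
    refine key.trans (ENNReal.ofReal_le_ofReal (le_of_eq ?_))
    obtain ⟨-, -, i32⟩ := rate_pow_identities (κ := κ) hK₀ Cq.coe_nonneg ht0
    have hPval : (P : ℝ) = Cq * (K₀ * (-t) ^ (-κ)) ^ 2 := by
      rw [hP, NNReal.coe_mul, NNReal.coe_pow, hMval]
    have hP0 : 0 ≤ (P : ℝ) := P.coe_nonneg
    have hV0 : 0 ≤ Vc ^ (1 - 2 / q) := by positivity
    rw [Real.mul_rpow hBΘ0 (mul_nonneg hV0 hP0), Real.mul_rpow hV0 hP0, hPval, i32, hA]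
    ring
  -- measurability
  have hcyl_sub : parabolicCylinder ρ ((0 : ℝ), x₀) ⊆ Iio (0 : ℝ) ×ˢ (univ : Set (EuclideanSpace ℝ (Fin 3))) := by
    intro w hw
    rw [mem_parabolicCylinder] at hw
    exact ⟨(hw.1.2 : w.1 < 0), mem_univ _⟩
  have hcont : ContinuousOn (uncurry fun t x => p t x - m t) (Iio 0 ×ˢ univ) :=
    hsol.smooth_pressure.continuousOn.sub (hm.continuousOn.comp continuousOn_fst fun w hw => hw.1)
  have hmeas : AEStronglyMeasurable (uncurry fun t x => p t x - m t)
      (volume.restrict (parabolicCylinder ρ ((0 : ℝ), x₀))) :=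
    (hcont.mono hcyl_sub).aestronglyMeasurable (isOpen_parabolicCylinder _ _).measurableSet
  refine ⟨hmeas, ?_⟩
  -- the `L^{3/2}` bound by Tonelli
  have h32 : ((3 / 2 : ℝ≥0∞)).toReal = (3 / 2 : ℝ) := by rw [ENNReal.toReal_div]; norm_num
  have h0 : (3 / 2 : ℝ≥0∞) ≠ 0 := by norm_num
  have htop : (3 / 2 : ℝ≥0∞) ≠ ⊤ := ENNReal.div_ne_top (by norm_num) (by norm_num)
  rw [eLpNorm_lt_top_iff_lintegral_rpow_enorm_lt_top h0 htop, h32]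
  set F : ℝ × (EuclideanSpace ℝ (Fin 3)) → ℝ≥0∞ := fun w => ‖p w.1 w.2 - m w.1‖ₑ ^ (3 / 2 : ℝ) with hF
  have cF : ContinuousOn F (Iio 0 ×ˢ univ) := by
    have h1 : ContinuousOn (fun w : ℝ × (EuclideanSpace ℝ (Fin 3)) => ‖p w.1 w.2 - m w.1‖ₑ) (Iio 0 ×ˢ univ) :=
      continuous_enorm.comp_continuousOn hcont
    exact (ENNReal.continuous_rpow_const.comp_continuousOn h1)
  show ∫⁻ w in parabolicCylinder ρ ((0 : ℝ), x₀), F w < ⊤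
  have hvol : (volume : Measure (ℝ × (EuclideanSpace ℝ (Fin 3)))) =
      (volume : Measure ℝ).prod (volume : Measure (EuclideanSpace ℝ (Fin 3))) := rfl
  have hFm : AEMeasurable F ((volume.restrict (Ioo (0 - ρ ^ 2) 0)).prod (volume.restrict (ball x₀ ρ))) := by
    rw [Measure.prod_restrict]
    exact (cF.mono hcyl_sub).aemeasurable (measurableSet_Ioo.prod measurableSet_ball)
  rw [parabolicCylinder, hvol, ← Measure.prod_restrict, lintegral_prod _ hFm]
  have hIoo : Ioo ((0 : ℝ) - ρ ^ 2) 0 ⊆ Ioo (-T) 0 := fun s hs => ⟨by linarith [hs.1], hs.2⟩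
  calc ∫⁻ s in Ioo ((0 : ℝ) - ρ ^ 2) 0, ∫⁻ x in ball x₀ ρ, F (s, x)
      ≤ ∫⁻ s in Ioo ((0 : ℝ) - ρ ^ 2) 0, ENNReal.ofReal (A * (-s) ^ (-(3 * κ))) :=
        setLIntegral_mono' measurableSet_Ioo fun s hs => hslice s (hIoo hs)
    _ = ENNReal.ofReal (∫ s in Ioo ((0 : ℝ) - ρ ^ 2) 0, A * (-s) ^ (-(3 * κ))) := by
        refine (ofReal_integral_eq_lintegral_ofReal ((integrableOn_rpow_neg_Ioo hκ3 _).const_mul A) ?_).symm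
        refine (ae_restrict_iff' measurableSet_Ioo).2 (ae_of_all _ fun s hs => ?_)
        exact mul_nonneg hA0 (Real.rpow_nonneg (by linarith [hs.2]) _)
    _ < ⊤ := ENNReal.ofReal_lt_top

end ChaeWolfEnergy

end Literature.Analysis.FluidPDE

end
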